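import Mathlib
import Summits.KontsevichZagierPeriods.KontsevichZagierPeriods.Theorems.SoloInformedScaleDatum
import HarnessLib
import HarnessLib.Audit

/-!
# SoloInformed — the SCALE BAND step: semialgebraicity, measurability, null walls

Solo programme `solo-KontsevichZagierPeriods-informed`, session s48 (PROGRAMME L, file 3).

For a scale datum `T` (file `SoloInformedScaleDatum`): the domains `D_A`, `bandM`, `bandN` are
`ℚ`-semialgebraic (hence measurable); the integrands `f_A, f_B`, the primitive `F` and the band
integrand `g` are `ℚ`-semialgebraic functions (quotients of explicit polynomials, the scaled point
`y|ᵢ ↦ λyᵢ` being the polynomial substitution `soloInformedScaleDatum.vhat`); and the two walls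
between the swapped band `{w | w ∘ e ∈ bandM}` and `bandN` are Lebesgue-null (contained in zero sets
of the non-zero polynomials `X_{i}`, `X_{i} − 1`, `X_last − 1`, `X_last − Ω`).

References: Kontsevich–Zagier 2001 §1.2 [KontsevichZagier2001]; BCR 1998 §2.1 (semialgebraic
sets and maps).
-/

noncomputable section

open MeasureTheory Set MvPolynomial
open Literature.ModelTheory.ExponentialFields Literature.NumberTheory.Transcendental
open Literature.NumberTheory.Transcendental.KZ

namespace Summit.KontsevichZagierPeriods.KontsevichZagierPeriods.Theorems

/-- The first `n` coordinate polynomials of `ℚ[X₀,…,Xₙ]`. -/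
def soloInformedCastX (n : ℕ) : Fin n → MvPolynomial (Fin (n + 1)) ℚ := fun j => X (Fin.castSucc j)

/-- Evaluating a renamed polynomial: `(rename castSucc p)(w) = p(init w)`. [folklore] -/
theorem soloInformed_aeval_rename_castSucc {n : ℕ} (p : MvPolynomial (Fin n) ℚ)
    (w : Fin (n + 1) → ℝ) : (aeval w (rename Fin.castSucc p) : ℝ) = aeval (Fin.init w) p := by
  rw [aeval_rename]; rfl

namespace SoloInformedScaleDatum

variable {n : ℕ} (T : SoloInformedScaleDatum n)

/-! ## 1. The sets -/

/-- Auxiliary (scale step): `D_A ⊆ D`. -/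
theorem DA_subset : T.DA ⊆ T.D := inter_subset_left

/-- Auxiliary (scale step): `D` is measurable. -/
theorem measurableSet_D : MeasurableSet T.D :=
  IsSemialgebraic.measurableSet_holds T.isSemialgebraic_D

/-- Auxiliary (scale step): `D_A` is semialgebraic. -/
theorem isSemialgebraic_DA : IsSemialgebraic ℚ T.DA := by
  refine T.isSemialgebraic_D.inter ?_
  simpa [ω] using isSemialgebraic_setOf_eval_lt (k := ℚ) (R := ℝ) T.Ω (X T.i)

/-- Auxiliary (scale step): `D_A` is measurable. -/
theorem measurableSet_DA : MeasurableSet T.DA :=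
  IsSemialgebraic.measurableSet_holds T.isSemialgebraic_DA

/-- Auxiliary (scale step): the half-space `{λ ≤ 1}` is semialgebraic. -/
theorem isSemialgebraic_last_le_one :
    IsSemialgebraic ℚ {w : Fin (n + 1) → ℝ | w (Fin.last n) ≤ 1} := by
  have hS : {w : Fin (n + 1) → ℝ | w (Fin.last n) ≤ 1} =
      {w | (aeval w (X (Fin.last n) : MvPolynomial (Fin (n + 1)) ℚ) : ℝ) ≤
        aeval w (1 : MvPolynomial (Fin (n + 1)) ℚ)} := by
    ext w; simp
  rw [hS]
  exact isSemialgebraic_setOf_eval_le (k := ℚ) (R := ℝ) _ _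

/-- Auxiliary (scale step): the half-space `{0 ≤ λ}` is semialgebraic. -/
theorem isSemialgebraic_zero_le_last :
    IsSemialgebraic ℚ {w : Fin (n + 1) → ℝ | 0 ≤ w (Fin.last n)} := by
  have hS : {w : Fin (n + 1) → ℝ | 0 ≤ w (Fin.last n)} =
      {w | (aeval w (0 : MvPolynomial (Fin (n + 1)) ℚ) : ℝ) ≤
        aeval w (X (Fin.last n) : MvPolynomial (Fin (n + 1)) ℚ)} := by
    ext w; simp
  rw [hS]
  exact isSemialgebraic_setOf_eval_le (k := ℚ) (R := ℝ) _ _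

/-- Auxiliary (scale step): `{ω(init w) ≤ λ}` is semialgebraic. -/
theorem isSemialgebraic_ω_le_last :
    IsSemialgebraic ℚ {w : Fin (n + 1) → ℝ | T.ω (Fin.init w) ≤ w (Fin.last n)} := by
  have hS : {w : Fin (n + 1) → ℝ | T.ω (Fin.init w) ≤ w (Fin.last n)} =
      {w | (aeval w (rename Fin.castSucc T.Ω) : ℝ) ≤
        aeval w (X (Fin.last n) : MvPolynomial (Fin (n + 1)) ℚ)} := by
    ext w; simp only [mem_setOf_eq, soloInformed_aeval_rename_castSucc, aeval_X]; rfl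
  rw [hS]
  exact isSemialgebraic_setOf_eval_le (k := ℚ) (R := ℝ) _ _

/-- **`bandN` is semialgebraic.** -/
theorem isSemialgebraic_bandN : IsSemialgebraic ℚ T.bandN := by
  have hB : T.bandN = {w : Fin (n + 1) → ℝ | Fin.init w ∈ T.D} ∩
      ({w | T.ω (Fin.init w) ≤ w (Fin.last n)} ∩ {w | w (Fin.last n) ≤ 1}) := by
    ext w; simp only [mem_bandN, mem_inter_iff, mem_setOf_eq]
  rw [hB]
  exact T.isSemialgebraic_D.setOf_init_mem.inter
    (T.isSemialgebraic_ω_le_last.inter isSemialgebraic_last_le_one)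

/-- **`bandM` is semialgebraic.** -/
theorem isSemialgebraic_bandM : IsSemialgebraic ℚ T.bandM := by
  have hB : T.bandM = {w : Fin (n + 1) → ℝ | Fin.init w ∈ T.DA} ∩
      ({w | 0 ≤ w (Fin.last n)} ∩ {w | w (Fin.last n) ≤ 1}) := by
    ext w; simp only [mem_bandM, mem_inter_iff, mem_setOf_eq]
  rw [hB]
  exact T.isSemialgebraic_DA.setOf_init_mem.inter
    (isSemialgebraic_zero_le_last.inter isSemialgebraic_last_le_one)

/-- Auxiliary (scale step): `bandN` is measurable. -/
theorem measurableSet_bandN : MeasurableSet T.bandN :=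
  IsSemialgebraic.measurableSet_holds T.isSemialgebraic_bandN

/-- Auxiliary (scale step): `bandM` is measurable. -/
theorem measurableSet_bandM : MeasurableSet T.bandM :=
  IsSemialgebraic.measurableSet_holds T.isSemialgebraic_bandM

/-- The cylinder `{(y, λ) | y ∈ D, 0 ≤ λ ≤ 1}` containing both bands. -/
def cyl : Set (Fin (n + 1) → ℝ) :=
  {w | (Fin.init w : Fin n → ℝ) ∈ T.D ∧ 0 ≤ w (Fin.last n) ∧ w (Fin.last n) ≤ 1}

/-- Auxiliary (scale step): the cylinder is semialgebraic. -/
theorem isSemialgebraic_cyl : IsSemialgebraic ℚ T.cyl := by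
  have hB : T.cyl = {w : Fin (n + 1) → ℝ | Fin.init w ∈ T.D} ∩
      ({w | 0 ≤ w (Fin.last n)} ∩ {w | w (Fin.last n) ≤ 1}) := by
    ext w; simp only [cyl, mem_inter_iff, mem_setOf_eq]
  rw [hB]
  exact T.isSemialgebraic_D.setOf_init_mem.inter
    (isSemialgebraic_zero_le_last.inter isSemialgebraic_last_le_one)

/-- Auxiliary (scale step): `bandM ⊆ cyl`. -/
theorem bandM_subset_cyl : T.bandM ⊆ T.cyl := fun _ hw =>
  ⟨T.DA_subset hw.1, hw.2.1, hw.2.2⟩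

/-- Auxiliary (scale step): `bandN ⊆ cyl`. -/
theorem bandN_subset_cyl : T.bandN ⊆ T.cyl := fun _ hw =>
  ⟨hw.1, (ω_pos hw.1).le.trans hw.2.1, hw.2.2⟩

/-- On the cylinder the scaled point has `Q ≠ 0`, and `C(1 − ω) > 0`. -/
theorem cyl_ne {w : Fin (n + 1) → ℝ} (hw : w ∈ T.cyl) :
    (aeval (T.pt w) T.Q : ℝ) ≠ 0 ∧ 0 < T.cc (Fin.init w) * (1 - T.ω (Fin.init w)) := by
  have hy := hw.1
  have hyi := T.mem_Ioo _ hy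
  exact ⟨q_ne hy (mul_nonneg hw.2.1 hyi.1.le) (mul_le_one₀ hw.2.2 hyi.1.le hyi.2.le), K_pos hy⟩

/-! ## 2. The polynomial substitutions -/

/-- The substitution `Xⱼ ↦ X_{castSucc j}` (`j ≠ i`), `Xᵢ ↦ X_last · X_{castSucc i}`. -/
def vhat : Fin n → MvPolynomial (Fin (n + 1)) ℚ :=
  Function.update (soloInformedCastX n) T.i (X (Fin.last n) * soloInformedCastX n T.i)

/-- The substitution `Xⱼ ↦ Xⱼ` (`j ≠ i`), `Xᵢ ↦ Ω · Xᵢ`. -/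
def vΩ : Fin n → MvPolynomial (Fin n) ℚ := Function.update X T.i (T.Ω * X T.i)

/-- `(bind₁ vhat p)(w) = p(scaled point of w)`. -/
theorem aeval_hat (p : MvPolynomial (Fin n) ℚ) (w : Fin (n + 1) → ℝ) :
    (aeval w (bind₁ T.vhat p) : ℝ) = aeval (T.pt w) p := by
  rw [vhat, soloInformed_aeval_bind₁_update]
  have h : (fun j => (aeval w (soloInformedCastX n j) : ℝ)) = Fin.init w := by
    funext j; simp [soloInformedCastX, Fin.init]
  rw [h, pt]
  congr 1
  simp [soloInformedCastX, Fin.init]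

/-- `(bind₁ vΩ p)(x) = p(x|xᵢ ↦ ω xᵢ)`. -/
theorem aeval_vΩ (p : MvPolynomial (Fin n) ℚ) (x : Fin n → ℝ) :
    (aeval x (bind₁ T.vΩ p) : ℝ) = aeval (Function.update x T.i (T.ω x * x T.i)) p := by
  rw [vΩ, soloInformed_aeval_bind₁_update]
  have h : (fun j => (aeval x (X j : MvPolynomial (Fin n) ℚ) : ℝ)) = x := by
    funext j; simp
  rw [h]
  simp [ω]

/-! ## 3. Semialgebraic functions -/

/-- **`f_A` is semialgebraic on `D_A`.** -/
theorem isSemialgebraicFunOn_fA : IsSemialgebraicFunOn ℚ T.DA T.fA := by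
  refine soloInformed_isSemialgebraicFunOn_quot T.isSemialgebraic_DA T.P (T.Q * T.C * (1 - T.Ω)) _
    (fun x hx => ?_) (fun x hx => ?_)
  · have h1 := q_ne_self hx.1
    have h2 := (T.C_pos _ hx.1).ne'
    have h3 := (sub_pos.2 (ω_lt_one hx.1)).ne'
    simp only [ω] at h3
    simpa using mul_ne_zero (mul_ne_zero h1 h2) h3
  · have h1 := q_ne_self hx.1
    have h2 := (T.C_pos _ hx.1).ne'
    have h3 := (sub_pos.2 (ω_lt_one hx.1)).ne'
    simp only [fA, φ, cc, ω, map_mul, map_sub, map_one] at h1 h2 h3 ⊢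
    field_simp

/-- **`f_B` is semialgebraic on `D`.** -/
theorem isSemialgebraicFunOn_fB : IsSemialgebraicFunOn ℚ T.D T.fB := by
  refine soloInformed_isSemialgebraicFunOn_quot T.isSemialgebraic_D
    (T.P * bind₁ T.vΩ T.Q - T.Ω * bind₁ T.vΩ T.P * T.Q)
    (T.Q * bind₁ T.vΩ T.Q * T.C * (1 - T.Ω)) _ (fun x hx => ?_) (fun x hx => ?_)
  · have h1 := q_ne_self hx
    have h2 : (aeval (Function.update x T.i (T.ω x * x T.i)) T.Q : ℝ) ≠ 0 :=
      q_ne hx (mul_pos (ω_pos hx) (T.mem_Ioo x hx).1).le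
        (mul_le_one₀ (ω_lt_one hx).le (T.mem_Ioo x hx).1.le (T.mem_Ioo x hx).2.le)
    have h3 := (T.C_pos _ hx).ne'
    have h4 := (sub_pos.2 (ω_lt_one hx)).ne'
    simp only [ω] at h4
    simp only [map_mul, map_sub, map_one, aeval_vΩ]
    exact mul_ne_zero (mul_ne_zero (mul_ne_zero h1 h2) h3) h4
  · have h1 := q_ne_self hx
    have h2 : (aeval (Function.update x T.i (T.ω x * x T.i)) T.Q : ℝ) ≠ 0 :=
      q_ne hx (mul_pos (ω_pos hx) (T.mem_Ioo x hx).1).le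
        (mul_le_one₀ (ω_lt_one hx).le (T.mem_Ioo x hx).1.le (T.mem_Ioo x hx).2.le)
    have h3 := (T.C_pos _ hx).ne'
    have h4 := (sub_pos.2 (ω_lt_one hx)).ne'
    simp only [map_mul, map_sub, map_one, aeval_vΩ, fB_eq, φ, cc]
    simp only [ω] at h2 h4 ⊢
    field_simp

/-- **The primitive `F` is semialgebraic on the cylinder.** -/
theorem isSemialgebraicFunOn_F_cyl : IsSemialgebraicFunOn ℚ T.cyl T.F := by
  refine soloInformed_isSemialgebraicFunOn_quot T.isSemialgebraic_cyl
    (X (Fin.last n) * bind₁ T.vhat T.P)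
    (bind₁ T.vhat T.Q * rename Fin.castSucc T.C * (1 - rename Fin.castSucc T.Ω)) _
    (fun w hw => ?_) (fun w hw => ?_)
  · obtain ⟨h1, hK⟩ := T.cyl_ne hw
    have h2 := (T.C_pos _ hw.1).ne'
    have h3 := (sub_pos.2 (ω_lt_one hw.1)).ne'
    simp only [ω] at h3
    simp only [map_mul, map_sub, map_one, aeval_hat, soloInformed_aeval_rename_castSucc]
    exact mul_ne_zero (mul_ne_zero h1 h2) h3
  · obtain ⟨h1, hK⟩ := T.cyl_ne hw
    have h2 := (T.C_pos _ hw.1).ne'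
    have h3 := (sub_pos.2 (ω_lt_one hw.1)).ne'
    simp only [ω] at h3
    simp only [map_mul, map_sub, map_one, aeval_hat, soloInformed_aeval_rename_castSucc, aeval_X,
      F, φ, cc, ω]
    field_simp

/-- **The band integrand `g` is semialgebraic on the cylinder.** -/
theorem isSemialgebraicFunOn_g_cyl : IsSemialgebraicFunOn ℚ T.cyl T.g := by
  refine soloInformed_isSemialgebraicFunOn_quot T.isSemialgebraic_cyl
    (bind₁ T.vhat T.P * bind₁ T.vhat T.Q + X (Fin.last n) * X (Fin.castSucc T.i) *
      (bind₁ T.vhat T.Q * bind₁ T.vhat (pderiv T.i T.P) -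
        bind₁ T.vhat T.P * bind₁ T.vhat (pderiv T.i T.Q)))
    (bind₁ T.vhat T.Q ^ 2 * rename Fin.castSucc T.C * (1 - rename Fin.castSucc T.Ω)) _
    (fun w hw => ?_) (fun w hw => ?_)
  · obtain ⟨h1, hK⟩ := T.cyl_ne hw
    have h2 := (T.C_pos _ hw.1).ne'
    have h3 := (sub_pos.2 (ω_lt_one hw.1)).ne'
    simp only [ω] at h3
    simp only [map_mul, map_sub, map_one, map_pow, aeval_hat, soloInformed_aeval_rename_castSucc]
    exact mul_ne_zero (mul_ne_zero (pow_ne_zero 2 h1) h2) h3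
  · obtain ⟨h1, hK⟩ := T.cyl_ne hw
    have h2 := (T.C_pos _ hw.1).ne'
    have h3 := (sub_pos.2 (ω_lt_one hw.1)).ne'
    simp only [ω] at h3
    simp only [map_mul, map_sub, map_add, map_one, map_pow, aeval_hat,
      soloInformed_aeval_rename_castSucc, aeval_X, g, φ, φ', cc, ω]
    have hinit : w (Fin.castSucc T.i) = Fin.init w T.i := rfl
    rw [hinit]
    field_simp

/-- Auxiliary (scale step): `F` is semialgebraic on `bandM`. -/
theorem isSemialgebraicFunOn_F_bandM : IsSemialgebraicFunOn ℚ T.bandM T.F :=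
  T.isSemialgebraicFunOn_F_cyl.mono T.bandM_subset_cyl T.isSemialgebraic_bandM
/-- Auxiliary (scale step): `F` is semialgebraic on `bandN`. -/
theorem isSemialgebraicFunOn_F_bandN : IsSemialgebraicFunOn ℚ T.bandN T.F :=
  T.isSemialgebraicFunOn_F_cyl.mono T.bandN_subset_cyl T.isSemialgebraic_bandN
/-- Auxiliary (scale step): `g` is semialgebraic on `bandM`. -/
theorem isSemialgebraicFunOn_g_bandM : IsSemialgebraicFunOn ℚ T.bandM T.g :=
  T.isSemialgebraicFunOn_g_cyl.mono T.bandM_subset_cyl T.isSemialgebraic_bandM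
/-- Auxiliary (scale step): `g` is semialgebraic on `bandN`. -/
theorem isSemialgebraicFunOn_g_bandN : IsSemialgebraicFunOn ℚ T.bandN T.g :=
  T.isSemialgebraicFunOn_g_cyl.mono T.bandN_subset_cyl T.isSemialgebraic_bandN

/-- Auxiliary (scale step): `ω` is semialgebraic on `D`. -/
theorem isSemialgebraicFunOn_ω : IsSemialgebraicFunOn ℚ T.D T.ω :=
  isSemialgebraicFunOn_aeval T.isSemialgebraic_D T.Ω

/-- Auxiliary (scale step): a constant is semialgebraic on a semialgebraic set. -/
theorem isSemialgebraicFunOn_const' {s : Set (Fin n → ℝ)} (hs : IsSemialgebraic ℚ s) (q : ℚ) :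
    IsSemialgebraicFunOn ℚ s fun _ => (q : ℝ) :=
  (isSemialgebraicFunOn_aeval hs (MvPolynomial.C q : MvPolynomial (Fin n) ℚ)).congr
    fun x _ => by simp

/-- Auxiliary (scale step): `g` is a.e. strongly measurable on `bandN`. -/
theorem aestronglyMeasurable_g_bandN : AEStronglyMeasurable T.g (volume.restrict T.bandN) :=
  aestronglyMeasurable_of_isSemialgebraicFunOn T.isSemialgebraicFunOn_g_bandN T.measurableSet_bandN

/-! ## 4. The null walls of the swap -/

/-- Membership of the swapped point in `bandM`. -/
theorem comp_e_mem_bandM (w : Fin (n + 1) → ℝ) :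
    (fun j => w (T.e j)) ∈ T.bandM ↔ Function.update (Fin.init w) T.i (w (Fin.last n)) ∈ T.DA ∧
      0 ≤ Fin.init w T.i ∧ Fin.init w T.i ≤ 1 := by
  rw [mem_bandM, init_comp_e, e_last]
  rfl

/-- `X_{castSucc i} · (X_{castSucc i} − 1) ≠ 0`. -/
theorem wallM_poly_ne :
    (X (Fin.castSucc T.i) * (X (Fin.castSucc T.i) - 1) : MvPolynomial (Fin (n + 1)) ℚ) ≠ 0 := by
  intro h
  have h2 := congrArg (aeval (fun _ : Fin (n + 1) => (2 : ℝ))) h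
  simp only [map_mul, map_sub, map_one, aeval_X, map_zero] at h2
  norm_num at h2

/-- `(X_last − 1) · (X_last − Ω(init)) ≠ 0`. -/
theorem wallN_poly_ne :
    ((X (Fin.last n) - 1) * (X (Fin.last n) - rename Fin.castSucc T.Ω) :
      MvPolynomial (Fin (n + 1)) ℚ) ≠ 0 := by
  intro h
  set c : ℝ := aeval (0 : Fin n → ℝ) T.Ω with hc
  have h2 := congrArg (aeval (Fin.snoc (0 : Fin n → ℝ) (|c| + 2))) h
  simp only [map_mul, map_sub, map_one, aeval_X, map_zero, soloInformed_aeval_rename_castSucc,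
    Fin.snoc_last, Fin.init_snoc] at h2
  rw [← hc] at h2
  have h3 : (|c| + 2 - 1) * (|c| + 2 - c) = 0 := h2
  have h4 : 0 < |c| + 2 - 1 := by have := abs_nonneg c; linarith
  have h5 : 0 < |c| + 2 - c := by have := le_abs_self c; linarith
  exact (mul_pos h4 h5).ne' h3

/-- **The wall `{w | w ∘ e ∈ bandM} \ bandN` is null** (inside `{yᵢ = 0} ∪ {yᵢ = 1}`). -/
theorem null_M_diff_N : volume ({w | (fun j => w (T.e j)) ∈ T.bandM} \ T.bandN) = 0 := by
  refine soloInformed_volume_eq_zero_of_subset_zeroSet _ T.wallM_poly_ne fun w hw => ?_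
  have hM := (T.comp_e_mem_bandM w).1 hw.1
  have hN : ¬ (Fin.init w ∈ T.D ∧ T.ω (Fin.init w) ≤ w (Fin.last n) ∧ w (Fin.last n) ≤ 1) :=
    fun h => hw.2 ((T.mem_bandN w).2 h)
  have hD : Function.update (Fin.init w) T.i (w (Fin.last n)) ∈ T.D := hM.1.1
  have hlt : T.ω (Fin.init w) < w (Fin.last n) := by
    have h := hM.1.2
    simp only [mem_setOf_eq, Function.update_self, ω_update] at h
    exact h
  have hl1 : w (Fin.last n) ≤ 1 := by
    have h := (T.mem_Ioo _ hD).2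
    rw [Function.update_self] at h
    exact h.le
  have hyD : Fin.init w ∉ T.D := fun h => hN ⟨h, hlt.le, hl1⟩
  have hyi : Fin.init w T.i = 0 ∨ Fin.init w T.i = 1 := by
    by_contra hne
    rw [not_or] at hne
    have h0 : 0 < Fin.init w T.i := lt_of_le_of_ne hM.2.1 (Ne.symm hne.1)
    have h1 : Fin.init w T.i < 1 := lt_of_le_of_ne hM.2.2 hne.2
    have h := T.update_mem _ hD (Fin.init w T.i) h0 h1
    rw [Function.update_idem, Function.update_eq_self] at h
    exact hyD h
  have hci : w (Fin.castSucc T.i) = Fin.init w T.i := rfl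
  simp only [map_mul, map_sub, map_one, aeval_X, hci]
  rcases hyi with h | h <;> simp [h]

/-- **The wall `bandN \ {w | w ∘ e ∈ bandM}` is null** (inside `{λ = 1} ∪ {λ = ω}`). -/
theorem null_N_diff_M : volume (T.bandN \ {w | (fun j => w (T.e j)) ∈ T.bandM}) = 0 := by
  refine soloInformed_volume_eq_zero_of_subset_zeroSet _ T.wallN_poly_ne fun w hw => ?_
  have hN := (T.mem_bandN w).1 hw.1
  have hM : ¬ (Function.update (Fin.init w) T.i (w (Fin.last n)) ∈ T.DA ∧
      0 ≤ Fin.init w T.i ∧ Fin.init w T.i ≤ 1) := fun h => hw.2 ((T.comp_e_mem_bandM w).2 h)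
  have hyi := T.mem_Ioo _ hN.1
  have hl : w (Fin.last n) = 1 ∨ w (Fin.last n) = T.ω (Fin.init w) := by
    by_contra hne
    rw [not_or] at hne
    have h1 : w (Fin.last n) < 1 := lt_of_le_of_ne hN.2.2 hne.1
    have h0 : T.ω (Fin.init w) < w (Fin.last n) := lt_of_le_of_ne hN.2.1 (Ne.symm hne.2)
    have hD : Function.update (Fin.init w) T.i (w (Fin.last n)) ∈ T.D :=
      T.update_mem _ hN.1 _ ((ω_pos hN.1).trans h0) h1
    refine hM ⟨⟨hD, ?_⟩, hyi.1.le, hyi.2.le⟩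
    simp only [mem_setOf_eq, Function.update_self, ω_update]
    exact h0
  simp only [map_mul, map_sub, map_one, aeval_X, soloInformed_aeval_rename_castSucc]
  rcases hl with h | h
  · simp [h]
  · rw [h]; simp [ω]

end SoloInformedScaleDatum

end Summit.KontsevichZagierPeriods.KontsevichZagierPeriods.Theorems
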